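import Mathlib
import Summits.KontsevichZagierPeriods.KontsevichZagierPeriods.Theorems.SoloInformedLegendreBand
import Summits.KontsevichZagierPeriods.KontsevichZagierPeriods.Theorems.SoloInformedEulerLemniscate
import Literature.NumberTheory.Transcendental.KZSemiCanonicalReductionProofs
import HarnessLib
import HarnessLib.Audit

/-!
# Legendre's relation by moves, III: the kill of `∂_s A` (solo-informed, s33)

On the homotopy band `H = (0,1)² × [0, μ]` (coordinates `w = (s, t, m)`, `μ ∈ (0,1)` real
algebraic) the modulus derivative `∂_m F` of the Legendre integrand
`F = (1 − m s² − m't²) k`, `m' = 1 − m`, equals `∂_s A + ∂_t B` (the certificate of file I).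
Here: the three bands and their semialgebraicity, **`[H, ∂_s A]` is a relation of the
Kontsevich–Zagier calculus** (one Newton–Leibniz move along the `s`-fibre with vanishing boundary
values `A(0) = A(1) = 0`, fibre opened, coordinates permuted — file II).  File IV kills `∂_t B`
and concludes that every representation `[H, ∂_m F]` is a relation.

References: M. Kontsevich, D. Zagier, *Periods* (2001), §1.2; this work (solo-informed s33).
-/

noncomputable section

open MeasureTheory Set Filter
open scoped Classical

open Literature.NumberTheory.Transcendental Literature.NumberTheory.Transcendental.KZ
open Literature.ModelTheory.ExponentialFields

namespace Summit.KontsevichZagierPeriods.KontsevichZagierPeriods.Theorems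

/-! ### The three bands: membership and semialgebraicity -/

/-- Membership in the base `(0,1) × [0, μ]` (coordinates `(a, m)`). [folklore] -/
theorem soloInformed_legendre_mem_base {μ : ℝ} (y : Fin 2 → ℝ) :
    y ∈ KZlog.band {y : Fin 1 → ℝ | y 0 ∈ Ioo (0:ℝ) 1} (fun _ => 0) (fun _ => μ) ↔
      y 0 ∈ Ioo (0:ℝ) 1 ∧ 0 ≤ y 1 ∧ y 1 ≤ μ := by
  have h1 : (Fin.last 1 : Fin 2) = 1 := rfl
  simp only [KZlog.mem_band, mem_setOf_eq, Fin.init, Fin.castSucc_zero, h1]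

/-- Membership in the kill band `(0,1) × [0, μ] × [0, 1]` (coordinates `(a, m, b)`). [folklore] -/
theorem soloInformed_legendre_mem_band' {μ : ℝ} (u : Fin 3 → ℝ) :
    u ∈ KZlog.band (KZlog.band {y : Fin 1 → ℝ | y 0 ∈ Ioo (0:ℝ) 1} (fun _ => 0) (fun _ => μ))
        (fun _ => 0) (fun _ => 1) ↔
      u 0 ∈ Ioo (0:ℝ) 1 ∧ (0 ≤ u 1 ∧ u 1 ≤ μ) ∧ 0 ≤ u 2 ∧ u 2 ≤ 1 := by
  have h1 : (Fin.last 1 : Fin 2) = 1 := rfl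
  have h2 : (Fin.last 2 : Fin 3) = 2 := rfl
  have h3 : ((1 : Fin 2).castSucc : Fin 3) = 1 := rfl
  simp only [KZlog.mem_band, mem_setOf_eq, Fin.init, Fin.castSucc_zero, h1, h2, h3, and_assoc]

/-- Membership in the open kill band `(0,1) × [0, μ] × (0, 1)`. [folklore] -/
theorem soloInformed_legendre_mem_openBand' {μ : ℝ} (u : Fin 3 → ℝ) :
    u ∈ {u : Fin 3 → ℝ | Fin.init u ∈ KZlog.band {y : Fin 1 → ℝ | y 0 ∈ Ioo (0:ℝ) 1}
        (fun _ => 0) (fun _ => μ) ∧ 0 < u (Fin.last 2) ∧ u (Fin.last 2) < 1} ↔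
      u 0 ∈ Ioo (0:ℝ) 1 ∧ (0 ≤ u 1 ∧ u 1 ≤ μ) ∧ 0 < u 2 ∧ u 2 < 1 := by
  have h2 : (Fin.last 2 : Fin 3) = 2 := rfl
  have h3 : ((1 : Fin 2).castSucc : Fin 3) = 1 := rfl
  simp only [mem_setOf_eq, soloInformed_legendre_mem_base, Fin.init, Fin.castSucc_zero, h2, h3,
    and_assoc]

/-- Membership in the homotopy band `(0,1)² × [0, μ]` (coordinates `(s, t, m)`). [folklore] -/
theorem soloInformed_legendre_mem_hband {μ : ℝ} (w : Fin 3 → ℝ) :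
    w ∈ KZlog.band {z : Fin 2 → ℝ | z 0 ∈ Ioo (0:ℝ) 1 ∧ z 1 ∈ Ioo (0:ℝ) 1}
        (fun _ => 0) (fun _ => μ) ↔
      (w 0 ∈ Ioo (0:ℝ) 1 ∧ w 1 ∈ Ioo (0:ℝ) 1) ∧ 0 ≤ w 2 ∧ w 2 ≤ μ := by
  have h2 : (Fin.last 2 : Fin 3) = 2 := rfl
  have h3 : ((1 : Fin 2).castSucc : Fin 3) = 1 := rfl
  simp only [KZlog.mem_band, mem_setOf_eq, Fin.init, Fin.castSucc_zero, h2, h3]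

/-- The base `(0,1) × [0, μ]` is `ℚ`-semialgebraic for `μ` algebraic. [folklore] -/
theorem soloInformed_legendre_isSemialgebraic_base {μ : ℝ} (hμa : IsAlgebraic ℚ μ) :
    IsSemialgebraic ℚ (KZlog.band {y : Fin 1 → ℝ | y 0 ∈ Ioo (0:ℝ) 1}
      (fun _ => 0) (fun _ => μ)) :=
  KZlog.isSemialgebraic_band
    (isSemialgebraicFunOn_const_of_isAlgebraic BallPeeling.isSemialgebraic_posIoo isAlgebraic_zero)
    (isSemialgebraicFunOn_const_of_isAlgebraic BallPeeling.isSemialgebraic_posIoo hμa)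

/-- The kill band `(0,1) × [0, μ] × [0,1]` is `ℚ`-semialgebraic. [folklore] -/
theorem soloInformed_legendre_isSemialgebraic_band' {μ : ℝ} (hμa : IsAlgebraic ℚ μ) :
    IsSemialgebraic ℚ (KZlog.band (KZlog.band {y : Fin 1 → ℝ | y 0 ∈ Ioo (0:ℝ) 1}
      (fun _ => 0) (fun _ => μ)) (fun _ => 0) (fun _ => 1)) :=
  KZlog.isSemialgebraic_band
    (isSemialgebraicFunOn_const_of_isAlgebraic (soloInformed_legendre_isSemialgebraic_base hμa)
      isAlgebraic_zero)
    (isSemialgebraicFunOn_const_of_isAlgebraic (soloInformed_legendre_isSemialgebraic_base hμa)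
      isAlgebraic_one)

/-- The homotopy band `(0,1)² × [0, μ]` is `ℚ`-semialgebraic. [folklore] -/
theorem soloInformed_legendre_isSemialgebraic_hband {μ : ℝ} (hμa : IsAlgebraic ℚ μ) :
    IsSemialgebraic ℚ (KZlog.band {z : Fin 2 → ℝ | z 0 ∈ Ioo (0:ℝ) 1 ∧ z 1 ∈ Ioo (0:ℝ) 1}
      (fun _ => 0) (fun _ => μ)) :=
  KZlog.isSemialgebraic_band
    (isSemialgebraicFunOn_const_of_isAlgebraic
      (by rw [← soloInformed_box_two_eq]; exact isSemialgebraic_box 2) isAlgebraic_zero)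
    (isSemialgebraicFunOn_const_of_isAlgebraic
      (by rw [← soloInformed_box_two_eq]; exact isSemialgebraic_box 2) hμa)

/-! ### The kill of `∂_s A` -/

/-- **`[H, ∂_s A] ∼ 0`.**  There is a representation on the homotopy band `H = (0,1)² × [0,μ]`
with integrand `∂_s A = ½t²[1 − 2s² + ms²(1−s²)/(1−ms²)]·k` whose class is a relation: on the band
`(0,1) × [0,μ] × [0,1]` (coordinates `(t, m, s)`) the primitive `A = ½t²·s(1−s²)·k` is continuous on
the closed fibres and vanishes at `s = 0, 1`, so Newton–Leibniz in `s` gives `[band, ∂_s A] ∼ 0`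
(file II); open the fibres and rotate the coordinates. [this work] -/
theorem soloInformed_legendre_killA (μ : ℝ) (hμ : μ ∈ Ioo (0:ℝ) 1) (hμa : IsAlgebraic ℚ μ) :
    ∃ T : IntegralRep 3,
      T.domain = KZlog.band {z : Fin 2 → ℝ | z 0 ∈ Ioo (0:ℝ) 1 ∧ z 1 ∈ Ioo (0:ℝ) 1}
        (fun _ => 0) (fun _ => μ) ∧
      (∀ w, T.integrand w =
        w 1 ^ 2 / 2 * (1 - 2 * w 0 ^ 2 + w 2 * w 0 ^ 2 * (1 - w 0 ^ 2) / (1 - w 2 * w 0 ^ 2)) *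
          ((√(1 - w 0 ^ 2))⁻¹ * (√(1 - w 2 * w 0 ^ 2))⁻¹ *
            ((√(1 - w 1 ^ 2))⁻¹ * (√(1 - (1 - w 2) * w 1 ^ 2))⁻¹))) ∧
      of T ∈ relations := by
  have snoc0 : ∀ (x : Fin 2 → ℝ) (c : ℝ), (Fin.snoc x c : Fin 3 → ℝ) 0 = x 0 := fun _ _ => rfl
  have snoc1 : ∀ (x : Fin 2 → ℝ) (c : ℝ), (Fin.snoc x c : Fin 3 → ℝ) 1 = x 1 := fun _ _ => rfl
  have snoc2 : ∀ (x : Fin 2 → ℝ) (c : ℝ), (Fin.snoc x c : Fin 3 → ℝ) 2 = c := fun _ _ => rfl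
  have hμ1 : μ < 1 := hμ.2
  have hband' := soloInformed_legendre_isSemialgebraic_band' hμa
  have hw' : ∀ u ∈ KZlog.band (KZlog.band {y : Fin 1 → ℝ | y 0 ∈ Ioo (0:ℝ) 1}
      (fun _ => 0) (fun _ => μ)) (fun _ => 0) (fun _ => 1),
      (0 ≤ u 2 ∧ u 2 ≤ 1) ∧ (0 ≤ u 0 ∧ u 0 ≤ 1) ∧ 0 ≤ u 1 ∧ u 1 < 1 := by
    intro u hu
    rw [soloInformed_legendre_mem_band'] at hu
    exact ⟨hu.2.2, ⟨hu.1.1.le, hu.1.2.le⟩, hu.2.1.1, hu.2.1.2.trans_lt hμ1⟩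
  have hden : ∀ u ∈ KZlog.band (KZlog.band {y : Fin 1 → ℝ | y 0 ∈ Ioo (0:ℝ) 1}
      (fun _ => 0) (fun _ => μ)) (fun _ => 0) (fun _ => 1), 0 < 1 - u 1 * u 2 ^ 2 := by
    intro u hu
    rw [soloInformed_legendre_mem_band'] at hu
    have : u 1 * u 2 ^ 2 ≤ μ * 1 :=
      mul_le_mul hu.2.1.2 (by nlinarith [hu.2.2.1, hu.2.2.2]) (sq_nonneg _) hμ.1.le
    linarith
  -- semialgebraicity of the primitive and of the fibre derivative
  have hP : IsSemialgebraicFunOn ℚ (KZlog.band (KZlog.band {y : Fin 1 → ℝ | y 0 ∈ Ioo (0:ℝ) 1}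
      (fun _ => 0) (fun _ => μ)) (fun _ => 0) (fun _ => 1))
      (fun u => u 0 ^ 2 / 2 * (u 2 * (1 - u 2 ^ 2)) * ((√(1 - u 2 ^ 2))⁻¹ *
        (√(1 - u 1 * u 2 ^ 2))⁻¹ * ((√(1 - u 0 ^ 2))⁻¹ * (√(1 - (1 - u 1) * u 0 ^ 2))⁻¹))) := by
    refine soloInformed_legendre_sa_mul_kernel 2 0 1 hband' hw' ?_
    refine (IsSemialgebraicFunOn.mul_holds (isSemialgebraicFunOn_ratCast hband' (1/2))
      (isSemialgebraicFunOn_aeval hband' (MvPolynomial.X 0 ^ 2 *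
        (MvPolynomial.X 2 * (1 - MvPolynomial.X 2 ^ 2))))).congr fun u _ => ?_
    simp only [Pi.mul_apply, map_mul, map_sub, map_pow, map_one, MvPolynomial.aeval_X]
    push_cast
    ring
  have hg : IsSemialgebraicFunOn ℚ (KZlog.band (KZlog.band {y : Fin 1 → ℝ | y 0 ∈ Ioo (0:ℝ) 1}
      (fun _ => 0) (fun _ => μ)) (fun _ => 0) (fun _ => 1))
      (fun u => u 0 ^ 2 / 2 * (1 - 2 * u 2 ^ 2 + u 1 * u 2 ^ 2 * (1 - u 2 ^ 2) / (1 - u 1 * u 2 ^ 2)) *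
        ((√(1 - u 2 ^ 2))⁻¹ * (√(1 - u 1 * u 2 ^ 2))⁻¹ *
          ((√(1 - u 0 ^ 2))⁻¹ * (√(1 - (1 - u 1) * u 0 ^ 2))⁻¹))) := by
    refine soloInformed_legendre_sa_mul_kernel 2 0 1 hband' hw' ?_
    have hq : ∀ u ∈ KZlog.band (KZlog.band {y : Fin 1 → ℝ | y 0 ∈ Ioo (0:ℝ) 1}
        (fun _ => 0) (fun _ => μ)) (fun _ => 0) (fun _ => 1),
        MvPolynomial.aeval u (1 - MvPolynomial.X 1 * MvPolynomial.X 2 ^ 2 :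
          MvPolynomial (Fin 3) ℚ) ≠ 0 := by
      intro u hu
      have := hden u hu
      simp only [map_sub, map_one, map_mul, map_pow, MvPolynomial.aeval_X]
      exact this.ne'
    refine (IsSemialgebraicFunOn.mul_holds
      (IsSemialgebraicFunOn.mul_holds (isSemialgebraicFunOn_ratCast hband' (1/2))
        (isSemialgebraicFunOn_aeval hband' (MvPolynomial.X 0 ^ 2)))
      (IsSemialgebraicFunOn.add_holds
        (isSemialgebraicFunOn_aeval hband' (1 - 2 * MvPolynomial.X 2 ^ 2))
        (isSemialgebraicFunOn_aeval_div_aeval hband'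
          (MvPolynomial.X 1 * MvPolynomial.X 2 ^ 2 * (1 - MvPolynomial.X 2 ^ 2))
          (1 - MvPolynomial.X 1 * MvPolynomial.X 2 ^ 2) hq))).congr fun u _ => ?_
    simp only [Pi.mul_apply, Pi.add_apply, map_mul, map_sub, map_pow, map_one, map_ofNat,
      MvPolynomial.aeval_X]
    push_cast
    ring
  -- continuity of the primitive on the closed fibres
  have hcont : ∀ y ∈ KZlog.band {y : Fin 1 → ℝ | y 0 ∈ Ioo (0:ℝ) 1} (fun _ => 0) (fun _ => μ),
      ContinuousOn (fun b : ℝ => (fun u : Fin 3 → ℝ => u 0 ^ 2 / 2 * (u 2 * (1 - u 2 ^ 2)) *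
        ((√(1 - u 2 ^ 2))⁻¹ * (√(1 - u 1 * u 2 ^ 2))⁻¹ *
          ((√(1 - u 0 ^ 2))⁻¹ * (√(1 - (1 - u 1) * u 0 ^ 2))⁻¹))) (Fin.snoc y b)) (Icc 0 1) := by
    intro y hy
    rw [soloInformed_legendre_mem_base] at hy
    have hrad : ∀ b ∈ Icc (0:ℝ) 1, 0 < 1 - y 1 * b ^ 2 := by
      intro b hb
      have : y 1 * b ^ 2 ≤ μ * 1 :=
        mul_le_mul hy.2.2 (by nlinarith [hb.1, hb.2]) (sq_nonneg _) hμ.1.le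
      linarith
    have h1 : Continuous fun b : ℝ => y 0 ^ 2 / 2 * (b * √(1 - b ^ 2)) :=
      continuous_const.mul (continuous_id.mul
        (Real.continuous_sqrt.comp (continuous_const.sub (continuous_pow 2))))
    have h2 : ContinuousOn (fun b : ℝ => (√(1 - y 1 * b ^ 2))⁻¹) (Icc 0 1) :=
      ContinuousOn.inv₀ (Real.continuous_sqrt.comp
        (continuous_const.sub (continuous_const.mul (continuous_pow 2)))).continuousOn
        fun b hb => (Real.sqrt_pos.2 (hrad b hb)).ne'
    have hc : ContinuousOn (fun b : ℝ => y 0 ^ 2 / 2 * (b * √(1 - b ^ 2)) *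
        ((√(1 - y 1 * b ^ 2))⁻¹ * ((√(1 - y 0 ^ 2))⁻¹ * (√(1 - (1 - y 1) * y 0 ^ 2))⁻¹)))
        (Icc 0 1) :=
      h1.continuousOn.mul (h2.mul continuousOn_const)
    refine hc.congr fun b _ => ?_
    simp only [snoc0, snoc1, snoc2]
    rw [← soloInformed_mul_one_sub_sq_mul_inv_sqrt b]
    ring
  -- the fibre derivative
  have hder : ∀ y ∈ KZlog.band {y : Fin 1 → ℝ | y 0 ∈ Ioo (0:ℝ) 1} (fun _ => 0) (fun _ => μ),
      ∀ b ∈ Ioo (0:ℝ) 1, HasDerivAt (fun b : ℝ => (fun u : Fin 3 → ℝ => u 0 ^ 2 / 2 *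
        (u 2 * (1 - u 2 ^ 2)) * ((√(1 - u 2 ^ 2))⁻¹ * (√(1 - u 1 * u 2 ^ 2))⁻¹ *
          ((√(1 - u 0 ^ 2))⁻¹ * (√(1 - (1 - u 1) * u 0 ^ 2))⁻¹))) (Fin.snoc y b))
        ((fun u : Fin 3 → ℝ => u 0 ^ 2 / 2 *
          (1 - 2 * u 2 ^ 2 + u 1 * u 2 ^ 2 * (1 - u 2 ^ 2) / (1 - u 1 * u 2 ^ 2)) *
          ((√(1 - u 2 ^ 2))⁻¹ * (√(1 - u 1 * u 2 ^ 2))⁻¹ *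
            ((√(1 - u 0 ^ 2))⁻¹ * (√(1 - (1 - u 1) * u 0 ^ 2))⁻¹))) (Fin.snoc y b)) b := by
    intro y hy b hb
    rw [soloInformed_legendre_mem_base] at hy
    have key := soloInformed_legendre_hasDerivAt_s (s := b) (t := y 0) (m := y 1) hb
      (hy.2.2.trans_lt hμ1)
    simp only [snoc0, snoc1, snoc2]
    exact key
  -- integrability of the fibre derivative on the band, by domination
  have hint : IntegrableOn (fun u : Fin 3 → ℝ => u 0 ^ 2 / 2 *
      (1 - 2 * u 2 ^ 2 + u 1 * u 2 ^ 2 * (1 - u 2 ^ 2) / (1 - u 1 * u 2 ^ 2)) *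
      ((√(1 - u 2 ^ 2))⁻¹ * (√(1 - u 1 * u 2 ^ 2))⁻¹ *
        ((√(1 - u 0 ^ 2))⁻¹ * (√(1 - (1 - u 1) * u 0 ^ 2))⁻¹)))
      (KZlog.band (KZlog.band {y : Fin 1 → ℝ | y 0 ∈ Ioo (0:ℝ) 1}
        (fun _ => 0) (fun _ => μ)) (fun _ => 0) (fun _ => 1)) := by
    refine soloInformed_integrableOn_of_le_inv_sqrt_prod hband' hg ∅ {2} {1} {0, 2}
      (2 * (2 + (1 - μ)⁻¹) * (√(1 - μ))⁻¹)
      ({u | u 1 = 0} ∪ ({u | u 2 = 0} ∪ {u | u 2 = 1}))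
      (measure_union_null (by rw [volume_pi]; exact Measure.pi_hyperplane _ 1 0)
        (measure_union_null (by rw [volume_pi]; exact Measure.pi_hyperplane _ 2 0)
          (by rw [volume_pi]; exact Measure.pi_hyperplane _ 2 1)))
      (fun u hu hZ j => ?_) (fun u hu hc => ?_)
    · rw [soloInformed_legendre_mem_band'] at hu
      simp only [mem_union, mem_setOf_eq, not_or] at hZ
      fin_cases j
      · exact hu.1
      · exact ⟨lt_of_le_of_ne hu.2.1.1 (Ne.symm hZ.1), hu.2.1.2.trans_lt hμ1⟩
      · exact ⟨lt_of_le_of_ne hu.2.2.1 (Ne.symm hZ.2.1), lt_of_le_of_ne hu.2.2.2 hZ.2.2⟩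
    · rw [soloInformed_legendre_mem_band'] at hu
      have hs := hc 2
      have ht := hc 0
      have hm := hc 1
      obtain ⟨-, hA, -⟩ := soloInformed_legendre_factors_le (s := u 2) (t := u 0) (m := u 1)
        (μ := μ) hs ht hm.1.le hu.2.1.2 hμ1
      have hK := soloInformed_legendre_kernel_le (s := u 2) (t := u 0) (m := u 1) (μ := μ)
        hs ht hm.1 hu.2.1.2 hμ1
      have hK0 : 0 ≤ (√(1 - u 2 ^ 2))⁻¹ * (√(1 - u 1 * u 2 ^ 2))⁻¹ *
          ((√(1 - u 0 ^ 2))⁻¹ * (√(1 - (1 - u 1) * u 0 ^ 2))⁻¹) := by positivity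
      have hC0 : 0 ≤ 2 + (1 - μ)⁻¹ := add_nonneg zero_le_two (inv_nonneg.2 (by linarith))
      rw [abs_mul, abs_of_nonneg hK0, Finset.prod_empty, Finset.prod_singleton,
        Finset.prod_singleton, Finset.prod_pair (by decide)]
      calc |u 0 ^ 2 / 2 * (1 - 2 * u 2 ^ 2 + u 1 * u 2 ^ 2 * (1 - u 2 ^ 2) / (1 - u 1 * u 2 ^ 2))| *
            ((√(1 - u 2 ^ 2))⁻¹ * (√(1 - u 1 * u 2 ^ 2))⁻¹ *
              ((√(1 - u 0 ^ 2))⁻¹ * (√(1 - (1 - u 1) * u 0 ^ 2))⁻¹))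
          ≤ (2 + (1 - μ)⁻¹) * ((√(1 - μ))⁻¹ * (2 * (√(1 - u 2))⁻¹ +
              2 * ((√(1 - u 2))⁻¹ * (√(1 - u 0))⁻¹ * (√(u 1))⁻¹))) :=
            mul_le_mul hA hK hK0 hC0
        _ = 2 * (2 + (1 - μ)⁻¹) * (√(1 - μ))⁻¹ * (1 * (√(1 - u 2))⁻¹ +
              (√(u 1))⁻¹ * ((√(1 - u 0))⁻¹ * (√(1 - u 2))⁻¹)) := by ring
  -- vanishing boundary values
  have h0 : ∀ y ∈ KZlog.band {y : Fin 1 → ℝ | y 0 ∈ Ioo (0:ℝ) 1} (fun _ => 0) (fun _ => μ),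
      (fun u : Fin 3 → ℝ => u 0 ^ 2 / 2 * (u 2 * (1 - u 2 ^ 2)) *
        ((√(1 - u 2 ^ 2))⁻¹ * (√(1 - u 1 * u 2 ^ 2))⁻¹ *
          ((√(1 - u 0 ^ 2))⁻¹ * (√(1 - (1 - u 1) * u 0 ^ 2))⁻¹))) (Fin.snoc y 1) -
      (fun u : Fin 3 → ℝ => u 0 ^ 2 / 2 * (u 2 * (1 - u 2 ^ 2)) *
        ((√(1 - u 2 ^ 2))⁻¹ * (√(1 - u 1 * u 2 ^ 2))⁻¹ *
          ((√(1 - u 0 ^ 2))⁻¹ * (√(1 - (1 - u 1) * u 0 ^ 2))⁻¹))) (Fin.snoc y 0) = 0 := by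
    intro y _
    simp [snoc1, snoc2]
  obtain ⟨T, hTd, hTi, hT⟩ := soloInformed_legendre_kill _
    (soloInformed_legendre_isSemialgebraic_base hμa) _ _ hP hg hcont hder hint h0 (finRotate 3)
  have he0 : (finRotate 3) 0 = 1 := by decide
  have he1 : (finRotate 3) 1 = 2 := by decide
  have he2 : (finRotate 3) 2 = 0 := by decide
  refine ⟨T, ?_, fun w => ?_, hT⟩
  · rw [hTd]
    ext w
    have h1 : (Fin.last 1 : Fin 2) = 1 := rfl
    have h2 : (Fin.last 2 : Fin 3) = 2 := rfl
    have h3 : ((1 : Fin 2).castSucc : Fin 3) = 1 := rfl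
    simp only [mem_setOf_eq, KZlog.mem_band, Fin.init, Fin.castSucc_zero, h1, h2, h3, he0, he1,
      he2, mem_Ioo]
    constructor
    · rintro ⟨⟨h1', h2', h3'⟩, h4', h5'⟩; exact ⟨⟨⟨h4', h5'⟩, h1'⟩, h2', h3'⟩
    · rintro ⟨⟨⟨h4', h5'⟩, h1'⟩, h2', h3'⟩; exact ⟨⟨h1', h2', h3'⟩, h4', h5'⟩
  · simp only [hTi, he0, he1, he2]

end Summit.KontsevichZagierPeriods.KontsevichZagierPeriods.Theorems

end
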